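import Summits.HodgeConjecture.CorCM.GaloisCertificateQuotientLift
import Summits.HodgeConjecture.CorCM.GaloisCertificateSplitTwo
import Summits.HodgeConjecture.CorCM.GaloisSectionCount
import HarnessLib

/-!
# BAD ascends along EVERY quadratic extension of a large Galois CM field, part I: the pattern `𝟙_{T₀} + 𝟙_{T₀w}` through a
# kernel of order two WITHOUT a complement — CM, annihilation, and the twisted equations forced on a stabiliser

COR-CM (cell `pub-hodgecm2`), binder seat b04 (gen 31), count-neutral own lane «Galois-CM-type classification»; completes
`CorCM/GaloisCertificateQuotientLift` (`|ker| ≥ 3`, no splitting) and `CorCM/GaloisCertificateSplitTwo` (`|ker| = 2`, split) by the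
case `|ker f| = 2` WITHOUT any splitting hypothesis, at the price of a size condition (`|G| ≤ 2^(|Q|/8)`, i.e. `|Q| ≥ 56` or so).
KERNEL ONLY: theorems; no definition, no named fact, no `sorry`.  `HC_CM` is neither used nor claimed.

SETTING.  `f : G →* Q` surjective with `ker f = {1, n₁}` (so `n₁` is a central involution), `s` a set-section, `c ∈ G` with `c² = 1`
and `c₀ = f c` central in `Q`, an annihilator certificate `(T₀, b₀)` for `(Q, c₀)`, `Q` not of exponent `2`.  For `w ∈ Q` put
`F = T₀ ∩ T₀w`, `D₁ = T₀ ∖ T₀w`, `D₂ = T₀w ∖ T₀ = c₀D₁`; for points `P : Q → G` (`f ∘ P = id`) let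
  `S = f⁻¹(F) ⊔ P(D₁) ⊔ c·P(c₀ D₂)·n₁`      (fibre sizes `𝟙_{T₀} + 𝟙_{T₀w}`).
§1  `S` is a CM set for `c` (`pattern_cm`) and `b₀ ∘ f` is annihilated by all right translates of `S` (`pattern_annihilated`:
`Σ_{T₀} b₀ + Σ_{T₀w} b₀ = 0`) — for EVERY `w` and `P`.
§2  Stabilisers: `n₁` moves the single point over `D₁` (`D₁ ≠ ∅`), `c n₁` moves a full fibre over `F` onto an empty one (`F ≠ ∅`),
`c` never stabilises a CM set; an element `v` with `f v ∉ {1, c₀}` stabilising `S` maps `D₁` into `D₁ ⊔ D₂` and, for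
`P(q) = s(q)·n₁^{ε(q)}`, forces the TWISTED EQUATIONS `ε(ψ_v z) = ε(z) ⊻ τ_v(z)` on `D₁` (`constraint_of_stabiliser`), with
`ψ_v(z) ∈ {f(v)z, c₀f(v)z}` a fixed-point-free injection `D₁ → D₁` and `τ_v` an explicit twist read off `v s(z) s(f(v)z)⁻¹` and
`c s(c₀q) s(q)⁻¹`.
§3 (in part II, `CorCM/GaloisCertificateQuadraticLift`): `CorCM/GaloisSectionCount.exists_forall_violated` produces `ε` violating
one equation for every such `v` as soon as `|G| · 2^(|D₁|/2) < 2^|D₁|`; with `w` from `exists_forall_involution_translate_ne` or `c₀ w`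
(which swaps `F` and `D₁`) one has `|D₁| ≥ |T₀|/2 = |Q|/4`, so `|G| ≤ 2^(|Q|/8)` suffices (`exists_liftQuadratic_certificate`,
`exists_simple_degenerate_of_quadratic_quotient_certificate` there).  With `CorCM/GaloisCertificateQuotientLift` (degree `≥ 3`):
**a certificate on ANY quotient `Gal(K/ℚ)/N` (`c ∉ N`) lifts, provided `|Gal(K/ℚ)| ≤ 2^(|Gal/N|/8)` when `|N| = 2`** — BAD(K₀) ⟹
BAD(K) for every Galois CM extension `K ⊇ K₀` except possibly `[K:K₀] = 2 ∧ [K:ℚ] > 2^([K₀:ℚ]/8)` non-split through `c`; the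
`2`-groups with `[K:ℚ] ≤ 64` are covered by the seat's census (compute j224726: 9 020 non-split triples, all BAD).

## References

* [Kubota1965] T. Kubota, *On the field extension by complex multiplication*, Trans. AMS 118 (1965), §2, §4 Lemma 2.
* [Shimura1998] G. Shimura, *Abelian Varieties with Complex Multiplication and Modular Functions*, §6.2 Thm. 3, §8.2 Prop. 26.
* [Gordon1999HodgeAVSurvey] B. B. Gordon, *A survey of the Hodge conjecture for abelian varieties*, Thm. 6.4, §9.3.
-/

noncomputable section

open CategoryTheory CategoryTheory.Limits NumberField
open scoped BigOperators

namespace Summit.HodgeConjecture.CorCM.GaloisModels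

open Literature.NumberTheory.ComplexMultiplication
open Literature.AlgebraicGeometry.Motives (AbelianVariety CMType)
open Literature.AlgebraicGeometry.HodgeTheory
open Literature.AlgebraicGeometry.ComplexMultiplication (IsCMTypeRealisation)
open Literature.AlgebraicGeometry.Pohlmann1968
open Literature.Barriers.HodgeConjecture (divisorClassesSpan)

namespace QuadraticLift

section Model

variable {G Q : Type*} [Group G] [Group Q] {f : G →* Q} {s : Q → G} {n₁ : G}

/-! ## §0 Two-point fibres -/

/-- `ker f = {1, n₁}`: two elements of a fibre differ by `1` or `n₁`. [folklore] -/
theorem fiber_two (hker : ∀ n : G, f n = 1 → n = 1 ∨ n = n₁) {y y' : G} (h : f y' = f y) : y' = y ∨ y' = y * n₁ := by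
  rcases hker (y⁻¹ * y') (by rw [map_mul, map_inv, h, inv_mul_cancel]) with h1 | h1
  · left; exact (inv_mul_eq_one.1 h1).symm
  · right; rw [← h1, mul_inv_cancel_left]

/-- `y ≠ y n₁`. [folklore] -/
theorem ne_mul_ker (h₁ : n₁ ≠ 1) (y : G) : y ≠ y * n₁ := fun h => h₁ (mul_left_cancel (h.symm.trans (mul_one y).symm))

/-- `c x = y ↔ x = c y` for an involution `c`. [folklore] -/
theorem inv_mul_eq_iff_of_mul_self {c : G} (hcc : c * c = 1) (x y : G) : c * x = y ↔ x = c * y :=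
  ⟨fun h => by rw [← h, ← mul_assoc, hcc, one_mul], fun h => by rw [h, ← mul_assoc, hcc, one_mul]⟩

/-- The `Bool`-indexed kernel elements multiply by `xor`. [folklore] -/
theorem ite_mul_ite (hinv : n₁ * n₁ = 1) (b₁ b₂ : Bool) :
    ((if b₁ then n₁ else (1 : G)) * if b₂ then n₁ else 1) = if xor b₁ b₂ then n₁ else 1 := by
  cases b₁ <;> cases b₂ <;> simp [hinv]

/-- `n₁^{[b]} · n₁ = n₁^{[¬b]}`. [folklore] -/
theorem ite_mul_ker (hinv : n₁ * n₁ = 1) (b : Bool) : ((if b then n₁ else (1 : G)) * n₁) = if xor b true then n₁ else 1 := by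
  cases b <;> simp [hinv]

/-- … and are separated by any left translate. [folklore] -/
theorem bool_eq_of_mul_ite_eq (h₁ : n₁ ≠ 1) (y : G) {b₁ b₂ : Bool}
    (h : (y * if b₁ then n₁ else 1) = y * if b₂ then n₁ else 1) : b₁ = b₂ := by
  have h' := mul_left_cancel h
  cases b₁ <;> cases b₂ <;> simp_all [eq_comm]

/-- Normal form of an element of the fibre over `q`: `y = s(q) · n₁^{[y ≠ s q]}`. [folklore] -/
theorem eq_section_mul_ite [DecidableEq G] (hs : ∀ q, f (s q) = q) (h₁ : n₁ ≠ 1)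
    (hker : ∀ n : G, f n = 1 → n = 1 ∨ n = n₁) {y : G} {q : Q} (hy : f y = q) :
    y = s q * if decide (y ≠ s q) then n₁ else 1 := by
  rcases fiber_two hker (hy.trans (hs q).symm) with h | h
  · rw [h]; simp
  · have hne : y ≠ s q := by rw [h]; exact (ne_mul_ker h₁ (s q)).symm
    rw [h]; simp [hne, ← h]

/-! ## §1 The pattern set: CM and annihilation -/

variable [Fintype G] [DecidableEq G] [Fintype Q] [DecidableEq Q]

omit [Fintype G] [DecidableEq G] [Fintype Q] [DecidableEq Q] in
/-- **The pattern set is a CM set for `c`.** [cite: Shimura1998, §18.2 Lemma (i)] -/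
theorem pattern_cm (h₁ : n₁ ≠ 1) (hker : ∀ n : G, f n = 1 → n = 1 ∨ n = n₁) (c : G) (hcc : c * c = 1)
    (T₀ : Finset Q) (hcm : ∀ q : Q, q ∈ T₀ ↔ f c * q ∉ T₀) (w : Q) (P : Q → G) (hP : ∀ q, f (P q) = q) (S : Finset G)
    (hS : ∀ x, x ∈ S ↔ ((f x ∈ T₀ ∧ f x * w⁻¹ ∈ T₀) ∨ (f x ∈ T₀ ∧ f x * w⁻¹ ∉ T₀ ∧ x = P (f x)) ∨
      (f x ∉ T₀ ∧ f x * w⁻¹ ∈ T₀ ∧ x = c * P (f c * f x) * n₁))) (x : G) :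
    x ∈ S ↔ c * x ∉ S := by
  have hcc' : f c * f c = 1 := by rw [← map_mul, hcc, map_one]
  have e1 : (f c * f x ∈ T₀) ↔ f x ∉ T₀ :=
    ⟨fun h hx => (hcm (f x)).1 hx h, fun h => not_not.1 fun h' => h ((hcm (f x)).2 h')⟩
  have e2 : (f c * f x * w⁻¹ ∈ T₀) ↔ f x * w⁻¹ ∉ T₀ := by
    rw [mul_assoc]
    exact ⟨fun h hx => (hcm _).1 hx h, fun h => not_not.1 fun h' => h ((hcm _).2 h')⟩
  have e3 : f c * (f c * f x) = f x := by rw [← mul_assoc, hcc', one_mul]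
  have e4 : (c * x = P (f c * f x)) ↔ x = c * P (f c * f x) := inv_mul_eq_iff_of_mul_self hcc x _
  have e5 : (c * x = c * P (f x) * n₁) ↔ x = P (f x) * n₁ := by rw [mul_assoc, mul_left_cancel_iff]
  -- the two points of the fibre of `x`
  have two1 : x = P (f x) ∨ x = P (f x) * n₁ := fiber_two hker (by rw [hP])
  have two2 : x = c * P (f c * f x) ∨ x = c * P (f c * f x) * n₁ :=
    fiber_two hker (by rw [map_mul, hP, ← mul_assoc, hcc', one_mul])
  have hAB : ¬ (x = P (f x) ∧ x = P (f x) * n₁) := fun h => ne_mul_ker h₁ (P (f x)) (h.1.symm.trans h.2)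
  have hCD : ¬ (x = c * P (f c * f x) ∧ x = c * P (f c * f x) * n₁) :=
    fun h => ne_mul_ker h₁ (c * P (f c * f x)) (h.1.symm.trans h.2)
  rw [hS, hS, map_mul, e1, e2, e3, e4, e5]
  by_cases hx : f x ∈ T₀ <;> by_cases hxw : f x * w⁻¹ ∈ T₀
  · constructor
    · intro _
      rintro (⟨h1, -⟩ | ⟨h1, -, -⟩ | ⟨-, h2, -⟩)
      · exact h1 hx
      · exact h1 hx
      · exact h2 hxw
    · intro _; exact Or.inl ⟨hx, hxw⟩
  · constructor
    · rintro (⟨-, h2⟩ | ⟨-, -, h3⟩ | ⟨h1, -, -⟩)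
      · exact absurd h2 hxw
      · rintro (⟨h1', -⟩ | ⟨h1', -, -⟩ | ⟨-, -, h3'⟩)
        · exact h1' hx
        · exact h1' hx
        · exact hAB ⟨h3, h3'⟩
      · exact absurd hx h1
    · intro H
      rcases two1 with h | h
      · exact Or.inr (Or.inl ⟨hx, hxw, h⟩)
      · exact absurd (Or.inr (Or.inr ⟨not_not_intro hx, hxw, h⟩)) H
  · constructor
    · rintro (⟨h1, -⟩ | ⟨h1, -, -⟩ | ⟨-, -, h3⟩)
      · exact absurd h1 hx
      · exact absurd h1 hx
      · rintro (⟨-, h2'⟩ | ⟨-, -, h3'⟩ | ⟨h1', -, -⟩)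
        · exact h2' hxw
        · exact hCD ⟨h3', h3⟩
        · exact h1' hx
    · intro H
      rcases two2 with h | h
      · exact absurd (Or.inr (Or.inl ⟨hx, not_not_intro hxw, h⟩)) H
      · exact Or.inr (Or.inr ⟨hx, hxw, h⟩)
  · constructor
    · rintro (⟨h1, -⟩ | ⟨h1, -, -⟩ | ⟨-, h2, -⟩)
      · exact absurd h1 hx
      · exact absurd h1 hx
      · exact absurd h2 hxw
    · intro H; exact absurd (Or.inl ⟨hx, hxw⟩) H

/-- **`b₀ ∘ f` is annihilated by every right translate of the pattern set**: `Σ_{x ∈ S} b₀(f x · r) = Σ_{q ∈ T₀} b₀(q r) +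
Σ_{q ∈ T₀ w} b₀(q r) = 0`. [cite: Kubota1965, §2] -/
theorem pattern_annihilated (hs : ∀ q, f (s q) = q) (hn₁ : f n₁ = 1) (h₁ : n₁ ≠ 1)
    (hker : ∀ n : G, f n = 1 → n = 1 ∨ n = n₁) (c : G) (hcc : c * c = 1)
    (T₀ : Finset Q) (b₀ : Q → ℤ) (hann : ∀ g : Q, ∑ q ∈ T₀, b₀ (q * g) = 0) (w : Q)
    (P : Q → G) (hP : ∀ q, f (P q) = q) (S : Finset G)
    (hS : ∀ x, x ∈ S ↔ ((f x ∈ T₀ ∧ f x * w⁻¹ ∈ T₀) ∨ (f x ∈ T₀ ∧ f x * w⁻¹ ∉ T₀ ∧ x = P (f x)) ∨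
      (f x ∉ T₀ ∧ f x * w⁻¹ ∈ T₀ ∧ x = c * P (f c * f x) * n₁))) (g : G) :
    ∑ x ∈ S, b₀ (f (x * g)) = 0 := by
  classical
  have hcc' : f c * f c = 1 := by rw [← map_mul, hcc, map_one]
  simp only [map_mul]
  set r := f g with hr
  -- the three parts
  set SA := Finset.univ.filter fun x : G => f x ∈ T₀.filter fun q => q * w⁻¹ ∈ T₀ with hSA
  set SB := (T₀.filter fun q => q * w⁻¹ ∉ T₀).image P with hSB
  set SC := (Finset.univ.filter fun q : Q => q ∉ T₀ ∧ q * w⁻¹ ∈ T₀).image fun q => c * P (f c * q) * n₁ with hSC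
  have hSeq : S = SA ∪ (SB ∪ SC) := by
    ext x
    rw [hS, Finset.mem_union, Finset.mem_union]
    simp only [hSA, hSB, hSC, Finset.mem_filter, Finset.mem_univ, true_and, Finset.mem_image]
    constructor
    · rintro (⟨h1, h2⟩ | ⟨h1, h2, h3⟩ | ⟨h1, h2, h3⟩)
      · exact Or.inl ⟨h1, h2⟩
      · exact Or.inr (Or.inl ⟨f x, ⟨h1, h2⟩, h3.symm⟩)
      · exact Or.inr (Or.inr ⟨f x, ⟨h1, h2⟩, h3.symm⟩)
    · rintro (⟨h1, h2⟩ | ⟨q, ⟨h1, h2⟩, hq⟩ | ⟨q, ⟨h1, h2⟩, hq⟩)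
      · exact Or.inl ⟨h1, h2⟩
      · have hfx : f x = q := by rw [← hq, hP]
        exact Or.inr (Or.inl ⟨hfx ▸ h1, hfx ▸ h2, by rw [hfx]; exact hq.symm⟩)
      · have hfx : f x = q := by rw [← hq, map_mul, map_mul, hP, hn₁, mul_one, ← mul_assoc, hcc', one_mul]
        exact Or.inr (Or.inr ⟨hfx ▸ h1, hfx ▸ h2, by rw [hfx]; exact hq.symm⟩)
  have hdAB : Disjoint SA (SB ∪ SC) := by
    rw [Finset.disjoint_left]
    intro x hxA hxBC
    simp only [hSA, hSB, hSC, Finset.mem_filter, Finset.mem_univ, true_and, Finset.mem_union, Finset.mem_image] at hxA hxBC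
    rcases hxBC with ⟨q, ⟨h1, h2⟩, hq⟩ | ⟨q, ⟨h1, h2⟩, hq⟩
    · have hfx : f x = q := by rw [← hq, hP]
      exact h2 (hfx ▸ hxA.2)
    · have hfx : f x = q := by rw [← hq, map_mul, map_mul, hP, hn₁, mul_one, ← mul_assoc, hcc', one_mul]
      exact h1 (hfx ▸ hxA.1)
  have hdBC : Disjoint SB SC := by
    rw [Finset.disjoint_left]
    intro x hxB hxC
    simp only [hSB, hSC, Finset.mem_filter, Finset.mem_univ, true_and, Finset.mem_image] at hxB hxC
    obtain ⟨q, ⟨h1, -⟩, hq⟩ := hxB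
    obtain ⟨q', ⟨h1', -⟩, hq'⟩ := hxC
    have e : q = q' := by
      have a : f x = q := by rw [← hq, hP]
      have b : f x = q' := by rw [← hq', map_mul, map_mul, hP, hn₁, mul_one, ← mul_assoc, hcc', one_mul]
      exact a.symm.trans b
    exact h1' (e ▸ h1)
  rw [hSeq, Finset.sum_union hdAB, Finset.sum_union hdBC]
  -- part A: full fibres
  have hA : ∑ x ∈ SA, b₀ (f x * r) = 2 * ∑ q ∈ T₀.filter (fun q => q * w⁻¹ ∈ T₀), b₀ (q * r) := by
    rw [hSA, QuotientLift.sum_filter_map_mem hs _ (fun q => b₀ (q * r))]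
    congr 1
    have hk : (Finset.univ.filter fun n : G => f n = 1) = {1, n₁} := by
      ext n
      simp only [Finset.mem_filter, Finset.mem_univ, true_and, Finset.mem_insert, Finset.mem_singleton]
      exact ⟨hker n, fun h => by rcases h with rfl | rfl; exacts [map_one f, hn₁]⟩
    rw [hk, Finset.card_pair h₁.symm]; norm_num
  -- part B
  have hB : ∑ x ∈ SB, b₀ (f x * r) = ∑ q ∈ T₀.filter (fun q => q * w⁻¹ ∉ T₀), b₀ (q * r) := by
    rw [hSB, Finset.sum_image (fun q₁ _ q₂ _ h => by simpa [hP] using congrArg f h)]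
    simp only [hP]
  -- part C
  have hC : ∑ x ∈ SC, b₀ (f x * r) = ∑ q ∈ Finset.univ.filter (fun q : Q => q ∉ T₀ ∧ q * w⁻¹ ∈ T₀), b₀ (q * r) := by
    rw [hSC, Finset.sum_image (fun q₁ _ q₂ _ h => by
      have := congrArg f h
      simp only [map_mul, hP, hn₁, mul_one] at this
      exact mul_left_cancel (mul_left_cancel this))]
    refine Finset.sum_congr rfl fun q _ => ?_
    rw [map_mul, map_mul, hP, hn₁, mul_one, ← mul_assoc, hcc', one_mul]
  rw [hA, hB, hC]
  -- `Σ_{T₀} = Σ_F + Σ_{D₁}` and `Σ_{T₀ w} = Σ_F + Σ_{D₂}`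
  have hT : ∑ q ∈ T₀.filter (fun q => q * w⁻¹ ∈ T₀), b₀ (q * r) + ∑ q ∈ T₀.filter (fun q => q * w⁻¹ ∉ T₀), b₀ (q * r) = 0 := by
    rw [Finset.sum_filter_add_sum_filter_not, hann r]
  have hTw : ∑ q ∈ T₀.filter (fun q => q * w⁻¹ ∈ T₀), b₀ (q * r) +
      ∑ q ∈ Finset.univ.filter (fun q : Q => q ∉ T₀ ∧ q * w⁻¹ ∈ T₀), b₀ (q * r) = 0 := by
    have hsplit := Finset.sum_filter_add_sum_filter_not (Finset.univ.filter fun q : Q => q * w⁻¹ ∈ T₀) (fun q => q ∈ T₀)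
      (fun q => b₀ (q * r))
    have e1 : (Finset.univ.filter fun q : Q => q * w⁻¹ ∈ T₀).filter (fun q => q ∈ T₀) = T₀.filter fun q => q * w⁻¹ ∈ T₀ := by
      ext q; simp only [Finset.mem_filter, Finset.mem_univ, true_and]; tauto
    have e2 : (Finset.univ.filter fun q : Q => q * w⁻¹ ∈ T₀).filter (fun q => ¬ q ∈ T₀) =
        Finset.univ.filter fun q : Q => q ∉ T₀ ∧ q * w⁻¹ ∈ T₀ := by
      ext q; simp only [Finset.mem_filter, Finset.mem_univ, true_and]; tauto
    rw [e1, e2] at hsplit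
    rw [hsplit]
    -- `Σ_{q w⁻¹ ∈ T₀} b₀ (q r) = Σ_{t ∈ T₀} b₀ (t w r) = 0`
    have e3 : (Finset.univ.filter fun q : Q => q * w⁻¹ ∈ T₀) = T₀.image fun t => t * w := by
      ext q
      simp only [Finset.mem_filter, Finset.mem_univ, true_and, Finset.mem_image]
      exact ⟨fun h => ⟨q * w⁻¹, h, inv_mul_cancel_right q w⟩, fun ⟨t, ht, h⟩ => by rw [← h, mul_inv_cancel_right]; exact ht⟩
    rw [e3, Finset.sum_image (fun t₁ _ t₂ _ h => mul_right_cancel h)]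
    simp only [mul_assoc]
    exact hann (w * r)
  linarith

/-! ## §2 Stabilisers -/

omit [Fintype G] [Fintype Q] in
/-- A stabiliser `v` with `f v ∉ {1, c₀}` maps `D₁` into `D₁ ⊔ D₂` and satisfies the twisted equation at each point of `D₁`
(points `P(q) = s(q) · n₁^{[ε q]}`). [cite: Shimura1998, §8.2 Prop. 26] -/
theorem constraint_of_stabiliser (hs : ∀ q, f (s q) = q) (hn₁ : f n₁ = 1) (h₁ : n₁ ≠ 1)
    (hker : ∀ n : G, f n = 1 → n = 1 ∨ n = n₁) (hinv : n₁ * n₁ = 1)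
    (c : G) (hcc : c * c = 1) (T₀ : Finset Q) (hcm : ∀ q : Q, q ∈ T₀ ↔ f c * q ∉ T₀) (w : Q) (ε : Q → Bool)
    (S : Finset G)
    (hS : ∀ x, x ∈ S ↔ ((f x ∈ T₀ ∧ f x * w⁻¹ ∈ T₀) ∨ (f x ∈ T₀ ∧ f x * w⁻¹ ∉ T₀ ∧ x = s (f x) * if ε (f x) then n₁ else 1) ∨
      (f x ∉ T₀ ∧ f x * w⁻¹ ∈ T₀ ∧ x = c * (s (f c * f x) * if ε (f c * f x) then n₁ else 1) * n₁)))
    {v : G} (hstab : ∀ x, x ∈ S ↔ v * x ∈ S) {z : Q} (hz : z ∈ T₀) (hzw : z * w⁻¹ ∉ T₀) :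
    (if f v * z ∈ T₀ then f v * z else f c * (f v * z)) ∈ T₀ ∧
      (if f v * z ∈ T₀ then f v * z else f c * (f v * z)) * w⁻¹ ∉ T₀ ∧
      ε (if f v * z ∈ T₀ then f v * z else f c * (f v * z)) =
        xor (ε z) (if f v * z ∈ T₀ then decide (v * s z ≠ s (f v * z))
          else xor (xor (decide (v * s z ≠ s (f v * z))) (decide (c * s (f c * (f v * z)) ≠ s (f v * z)))) true) := by
  have hcc' : f c * f c = 1 := by rw [← map_mul, hcc, map_one]
  set u := f v with hu
  set p : G := s z * (if ε z then n₁ else 1) with hp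
  have hfp : f p = z := by rw [hp, map_mul, hs]; split_ifs <;> simp [hn₁]
  have hpS : p ∈ S := (hS p).2 (Or.inr (Or.inl ⟨hfp.symm ▸ hz, hfp.symm ▸ hzw, by rw [hfp]⟩))
  have hvp : v * p ∈ S := (hstab p).1 hpS
  have hfvp : f (v * p) = u * z := by rw [map_mul, hfp]
  -- the other point of the fibre over `z` is not in `S`, nor is its image under `v`
  have hp'S : p * n₁ ∉ S := by
    intro h
    rcases (hS _).1 h with ⟨-, h2⟩ | ⟨-, -, h3⟩ | ⟨h1', -, -⟩
    · rw [map_mul, hfp, hn₁, mul_one] at h2; exact hzw h2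
    · rw [map_mul, hfp, hn₁, mul_one, ← hp] at h3; exact ne_mul_ker h₁ p h3.symm
    · rw [map_mul, hfp, hn₁, mul_one] at h1'; exact h1' hz
  have hvp'S : v * p * n₁ ∉ S := by rw [mul_assoc]; exact fun h => hp'S ((hstab _).2 h)
  -- normal form of `v p`
  set α : Bool := decide (v * s z ≠ s (u * z)) with hα
  set γ : Bool := decide (c * s (f c * (u * z)) ≠ s (u * z)) with hγ
  have hvs : v * s z = s (u * z) * if α then n₁ else 1 := eq_section_mul_ite hs h₁ hker (by rw [map_mul, hs])
  have hvp_nf : v * p = s (u * z) * if xor α (ε z) then n₁ else 1 := by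
    rw [hp, ← mul_assoc, hvs, mul_assoc, ite_mul_ite hinv]
  by_cases huz : u * z ∈ T₀
  · -- then `u z ∈ D₁` (a full fibre would contain `v p n₁ ∉ S`)
    have huzw : u * z * w⁻¹ ∉ T₀ := by
      intro h
      apply hvp'S
      exact (hS _).2 (Or.inl ⟨by rw [map_mul, hfvp, hn₁, mul_one]; exact huz, by rw [map_mul, hfvp, hn₁, mul_one]; exact h⟩)
    simp only [if_pos huz]
    refine ⟨huz, huzw, ?_⟩
    -- `v p` is THE point over `u z`
    rcases (hS _).1 hvp with ⟨-, h2⟩ | ⟨-, -, h3⟩ | ⟨h1', -, -⟩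
    · exact absurd (hfvp ▸ h2) huzw
    · rw [hfvp, hvp_nf] at h3
      have := bool_eq_of_mul_ite_eq h₁ (s (u * z)) h3
      -- `xor α (ε z) = ε (u z)`
      rw [← this]
      cases α <;> cases ε z <;> rfl
    · exact absurd huz (hfvp ▸ h1')
  · -- then `u z ∈ D₂` (an empty fibre cannot contain `v p`), and `c₀ u z ∈ D₁`
    have huzw : u * z * w⁻¹ ∈ T₀ := by
      rcases (hS _).1 hvp with ⟨h1', -⟩ | ⟨h1', -, -⟩ | ⟨-, h2, -⟩
      · exact absurd (hfvp ▸ h1') huz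
      · exact absurd (hfvp ▸ h1') huz
      · exact hfvp ▸ h2
    simp only [if_neg huz]
    refine ⟨not_not.1 fun h => huz ((hcm (u * z)).2 h), by rw [mul_assoc]; exact (hcm _).1 huzw, ?_⟩
    -- `v p` is THE point over `u z ∈ D₂`: `c · s(c₀ u z) n₁^{[ε (c₀ u z)]} · n₁`
    rcases (hS _).1 hvp with ⟨h1', -⟩ | ⟨h1', -, -⟩ | ⟨-, -, h3⟩
    · exact absurd (hfvp ▸ h1') huz
    · exact absurd (hfvp ▸ h1') huz
    · rw [hfvp] at h3
      -- normal form of the right-hand side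
      have hcs : c * s (f c * (u * z)) = s (u * z) * if γ then n₁ else 1 :=
        eq_section_mul_ite hs h₁ hker (by rw [map_mul, hs, ← mul_assoc, hcc', one_mul])
      have hrhs : c * (s (f c * (u * z)) * if ε (f c * (u * z)) then n₁ else 1) * n₁ =
          s (u * z) * if xor (xor γ (ε (f c * (u * z)))) true then n₁ else 1 := by
        rw [← mul_assoc c, hcs, mul_assoc (s (u * z)), ite_mul_ite hinv, mul_assoc (s (u * z)), ite_mul_ker hinv]
      rw [hvp_nf, hrhs] at h3
      have := bool_eq_of_mul_ite_eq h₁ (s (u * z)) h3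
      -- `xor α (ε z) = xor (xor γ (ε (c₀ u z))) true`
      revert this
      cases α <;> cases γ <;> cases ε z <;> cases ε (f c * (u * z)) <;> simp

end Model

end QuadraticLift

end Summit.HodgeConjecture.CorCM.GaloisModels

end
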